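import Literature.NumberTheory.LFunctions.PrimeNumberTheoremErrorTermProofs
import HarnessLib

/-!
# Zhang (2022) §2, (2.9): `𝔓 := ∑_{p ∼ P} p = (1 + o(1)) P² 𝓛⁻⁷⁷`

Trunk T-ANT (NumberTheory/LFunctions). Y. Zhang, *Discrete mean estimates and the Landau–Siegel
zero*, arXiv:2211.02515v1 (2022) [Zhang2022LandauSiegel], §2 [p. 4 of the source]:

> (2.1) `𝓛 = log D`. … (2.6) `P = exp{𝓛⁹}`. For notational simplicity we write `p ∼ P` for
> `P < p < P(1 + 𝓛⁻⁶⁸)`. … Note that (2.9) `𝔓 := ∑_{p∼P} p = (1 + o(1)) P² 𝓛⁻⁷⁷`.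

**Status of the source: an unrefereed manuscript, a claimed result under adjudication** (in-tree
audit of v1: `Literature.NumberTheory.LFunctions.Zhang2022.not_ineq824`). (2.9) is the prime number
theorem on the window `(P, P(1 + 𝓛⁻⁶⁸))`: `#{p ∼ P} ∼ P𝓛⁻⁶⁸/log P = P𝓛⁻⁷⁷` and each `p ∼ P` is
`P(1 + O(𝓛⁻⁶⁸))`; the window is far longer than `P exp(−c√log P) = P exp(−c𝓛^{9/2})`, so de la
Vallée Poussin's error term suffices. This file defines `𝔓` and PROVES (2.9) with an explicit rate:

* `frakP D = ∑_{P < p < P(1+𝓛⁻⁶⁸)} p` (`P = exp((log D)⁹)`, `𝓛 = log D`);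
* `frakP_bounds` — for `D ≥ D₀`: `|𝔓 − P²𝓛⁻⁷⁷| ≤ 3𝓛⁻⁶⁸ · P²𝓛⁻⁷⁷`,
  from the tree's PROVED `|ϑ(x) − x| ≤ Cx/exp(c√log x)` (Montgomery–Vaughan Thm 6.9 (6.13),
  `ChebyshevThetaDeLaValleePoussin_holds`).

It is the normalising factor of Propositions 2.1, 7.1 and Lemmas 3.3–3.6, 5.6, 8.1 of the source
(`Section3MeanValues.lean`, `Section5PrimeSums.lean` state their bounds with `P²𝓛⁻⁷⁷`).
-/

noncomputable section

open Finset Real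

namespace Literature.NumberTheory.LFunctions.Zhang2022

/-- Zhang's `𝔓 := ∑_{p ∼ P} p`, the sum of the primes `p` with `P < p < P(1 + 𝓛⁻⁶⁸)`, where
`𝓛 = log D` and `P = exp(𝓛⁹)` ((2.6), (2.9)); as a function of the modulus `D`.
[cite: Zhang2022LandauSiegel, (2.9), p. 4] -/
def frakP (D : ℕ) : ℝ :=
  ∑ p ∈ (Finset.Ioo ⌊Real.exp (Real.log D ^ 9)⌋₊
      ⌈Real.exp (Real.log D ^ 9) * (1 + (Real.log D ^ 68)⁻¹)⌉₊).filter Nat.Prime, (p : ℝ)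

/-- Unfolding lemma for `frakP`. [folklore] -/
theorem frakP_def (D : ℕ) : frakP D =
    ∑ p ∈ (Finset.Ioo ⌊Real.exp (Real.log D ^ 9)⌋₊
      ⌈Real.exp (Real.log D ^ 9) * (1 + (Real.log D ^ 68)⁻¹)⌉₊).filter Nat.Prime, (p : ℝ) := rfl

/-- `Ioo a b = Ioc a (b − 1)` in `ℕ`. [folklore] -/
theorem Ioo_eq_Ioc_sub_one (a b : ℕ) : Finset.Ioo a b = Finset.Ioc a (b - 1) := by
  ext n; simp only [Finset.mem_Ioo, Finset.mem_Ioc]; omega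

/-- The window sum of `log p` is a difference of Chebyshev's `ϑ`: for naturals `a ≤ b`,
`∑_{a < p ≤ b} log p = ϑ(b) − ϑ(a)`. [folklore] -/
theorem sum_Ioc_log_eq_theta_sub (a b : ℕ) (hab : a ≤ b) :
    ∑ p ∈ (Finset.Ioc a b).filter Nat.Prime, Real.log p =
      Chebyshev.theta b - Chebyshev.theta a := by
  rw [Chebyshev.theta, Chebyshev.theta, Nat.floor_natCast, Nat.floor_natCast, Finset.sum_filter,
    Finset.sum_filter, Finset.sum_filter, ← Finset.sum_Ioc_consecutive _ (Nat.zero_le a) hab]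
  ring

/-- For every real `M` there is `D₀` with `log D ≥ M` for all `D ≥ D₀`. [folklore] -/
private theorem exists_nat_le_log'' (M : ℝ) : ∃ D₀ : ℕ, ∀ D : ℕ, D₀ ≤ D → M ≤ Real.log D := by
  refine ⟨⌈Real.exp M⌉₊ + 1, fun D hD => ?_⟩
  have h1 : Real.exp M ≤ D := by
    have : (⌈Real.exp M⌉₊ : ℝ) + 1 ≤ D := by exact_mod_cast hD
    linarith [Nat.le_ceil (Real.exp M)]
  have hD0 : (0 : ℝ) < D := lt_of_lt_of_le (Real.exp_pos M) h1
  rw [Real.le_log_iff_exp_le hD0]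
  exact h1

set_option maxHeartbeats 1600000 in
/-- **Zhang 2022, (2.9): `𝔓 = (1 + o(1))P²𝓛⁻⁷⁷`**, with the explicit rate `o(1) = O(𝓛⁻⁶⁸)`:
there is `D₀` such that for all `D ≥ D₀`, with `𝓛 = log D` and `P = exp(𝓛⁹)`,
`|𝔓 − P²𝓛⁻⁷⁷| ≤ 3𝓛⁻⁶⁸ · P²𝓛⁻⁷⁷`. Proof: `∑_{p∼P} log p = ϑ(u) − ϑ(P)` with `u` the largest
integer `< P(1+𝓛⁻⁶⁸)`, `= P𝓛⁻⁶⁸ + O(1 + P e^{−c𝓛⁴})` by de la Vallée Poussin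
(`ChebyshevThetaDeLaValleePoussin_holds`, `√log P = 𝓛^{9/2} ≥ 𝓛⁴`), and
`P/log(P(1+𝓛⁻⁶⁸)) ≤ p/log p ≤ P(1+𝓛⁻⁶⁸)/log P` termwise.
[cite: Zhang2022LandauSiegel, (2.9), p. 4] [cite: MontgomeryVaughan2007, Theorem 6.9 (6.13)] -/
theorem frakP_bounds :
    ∃ D₀ : ℕ, ∀ D : ℕ, D₀ ≤ D →
      |frakP D - Real.exp (Real.log D ^ 9) ^ 2 * (Real.log D ^ 77)⁻¹| ≤
        3 * (Real.log D ^ 68)⁻¹ * (Real.exp (Real.log D ^ 9) ^ 2 * (Real.log D ^ 77)⁻¹) := by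
  classical
  obtain ⟨c, hc, C, hθ⟩ := ChebyshevThetaDeLaValleePoussin_holds
  set C' : ℝ := max C 1 with hC'
  have hC'1 : 1 ≤ C' := le_max_right _ _
  have hC'0 : 0 < C' := by linarith
  have hθ' : ∀ x : ℝ, 2 ≤ x → |Chebyshev.theta x - x| ≤ C' * x / Real.exp (c * Real.sqrt (Real.log x)) :=
    fun x hx ↦ (hθ x hx).trans (div_le_div_of_nonneg_right
      (mul_le_mul_of_nonneg_right (le_max_left _ _) (by linarith)) (Real.exp_pos _).le)
  obtain ⟨D₀, hD₀⟩ := exists_nat_le_log'' (max 158 (max (Real.log (3 * C')) (137 / c + 1)))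
  refine ⟨D₀, fun D hD ↦ ?_⟩
  -- notation and sizes
  set L : ℝ := Real.log D with hLdef
  have hLs := hD₀ D hD
  have hL158 : 158 ≤ L := le_trans (le_max_left _ _) hLs
  have hLC : Real.log (3 * C') ≤ L := le_trans (le_trans (le_max_left _ _) (le_max_right _ _)) hLs
  have hLc : 137 / c + 1 ≤ L := le_trans (le_trans (le_max_right _ _) (le_max_right _ _)) hLs
  have hL1 : 1 ≤ L := by linarith
  have hL0 : 0 < L := by linarith
  set a : ℝ := (L ^ 68)⁻¹ with hadef
  have ha0 : 0 < a := by positivity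
  have ha1 : a ≤ 1 := inv_le_one_of_one_le₀ (one_le_pow₀ hL1)
  have hL9 : 1 ≤ L ^ 9 := one_le_pow₀ hL1
  set P : ℝ := Real.exp (L ^ 9) with hPdef
  have hP0 : 0 < P := Real.exp_pos _
  have hP3 : 3 ≤ P := by
    have := Real.add_one_le_exp (L ^ 9)
    have : (2 : ℝ) ≤ L ^ 9 := by nlinarith [one_le_pow₀ (n := 8) hL1]
    rw [hPdef]; linarith
  set P₁ : ℝ := P * (1 + a) with hP₁def
  have hPP₁ : P ≤ P₁ := by rw [hP₁def]; nlinarith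
  have hP₁2P : P₁ ≤ 2 * P := by rw [hP₁def]; nlinarith
  have hP₁0 : 0 < P₁ := by linarith
  have hlogP : Real.log P = L ^ 9 := by rw [hPdef, Real.log_exp]
  -- the key size facts: `3C' L¹³⁶ ≤ exp(c L⁴)` and `L¹³⁶ ≤ P`
  have hLexp : L ≤ Real.exp L := by linarith [Real.add_one_le_exp L]
  have hL136 : L ^ 136 ≤ Real.exp (136 * L) := by
    have e : Real.exp (136 * L) = Real.exp L ^ 136 := by
      rw [← Real.exp_nat_mul]; norm_num
    rw [e]; exact pow_le_pow_left₀ hL0.le hLexp 136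
  have h3C : 3 * C' ≤ Real.exp L := by
    have := Real.exp_le_exp.2 hLC; rwa [Real.exp_log (by positivity)] at this
  have hcL4 : 137 * L ≤ c * L ^ 4 := by
    have h1 : 137 / c ≤ L := by linarith
    have h2 : 137 ≤ c * L := by rwa [div_le_iff₀' hc] at h1
    have h3 : L ≤ L ^ 3 := by
      calc L = L ^ 1 := (pow_one L).symm
        _ ≤ L ^ 3 := pow_le_pow_right₀ hL1 (by norm_num)
    nlinarith
  have hkey : 3 * C' * L ^ 136 ≤ Real.exp (c * L ^ 4) := by
    calc 3 * C' * L ^ 136 ≤ Real.exp L * Real.exp (136 * L) :=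
          mul_le_mul h3C hL136 (by positivity) (Real.exp_pos _).le
      _ = Real.exp (137 * L) := by rw [← Real.exp_add]; ring_nf
      _ ≤ Real.exp (c * L ^ 4) := Real.exp_le_exp.2 hcL4
  have hPL : L ^ 136 ≤ P := by
    calc L ^ 136 ≤ Real.exp (136 * L) := hL136
      _ ≤ Real.exp (L ^ 9) := Real.exp_le_exp.2 (by
          have : L ^ 9 = L ^ 8 * L := by ring
          nlinarith [one_le_pow₀ (n := 8) hL1, pow_le_pow_left₀ (by norm_num : (0:ℝ) ≤ 158) hL158 8])
      _ = P := by rw [hPdef]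
  -- `ε := 3 C' P / exp(c L⁴) ≤ P a²` and `1 ≤ P a²`
  have hsqrt : ∀ x : ℝ, P ≤ x → L ^ 4 ≤ Real.sqrt (Real.log x) := by
    intro x hx
    have hlx : L ^ 9 ≤ Real.log x := by rw [← hlogP]; exact Real.log_le_log hP0 hx
    have h8 : L ^ 8 ≤ L ^ 9 := pow_le_pow_right₀ hL1 (by norm_num)
    calc L ^ 4 = Real.sqrt ((L ^ 4) ^ 2) := (Real.sqrt_sq (by positivity)).symm
      _ ≤ Real.sqrt (Real.log x) := Real.sqrt_le_sqrt (by nlinarith)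
  have hexp4 : 0 < Real.exp (c * L ^ 4) := Real.exp_pos _
  have hPa2 : P * a ^ 2 = P / L ^ 136 := by
    rw [hadef, div_eq_mul_inv, inv_pow, ← pow_mul]
  have hεle : 3 * C' * P / Real.exp (c * L ^ 4) ≤ P * a ^ 2 := by
    rw [hPa2, div_le_div_iff₀ hexp4 (by positivity)]
    calc 3 * C' * P * L ^ 136 = (3 * C' * L ^ 136) * P := by ring
      _ ≤ Real.exp (c * L ^ 4) * P := mul_le_mul_of_nonneg_right hkey hP0.le
      _ = P * Real.exp (c * L ^ 4) := mul_comm _ _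
  have h1le : 1 ≤ P * a ^ 2 := by
    rw [hPa2, le_div_iff₀ (by positivity), one_mul]; exact hPL
  -- the largest integer `u < P₁`
  set U : ℕ := ⌈P₁⌉₊ - 1 with hUdef
  have hceil1 : 1 ≤ ⌈P₁⌉₊ := Nat.one_le_iff_ne_zero.2 (Nat.ceil_pos.2 hP₁0).ne'
  have hUreal : (U : ℝ) = ⌈P₁⌉₊ - 1 := by rw [hUdef, Nat.cast_sub hceil1, Nat.cast_one]
  have hUlt : (U : ℝ) < P₁ := by rw [hUreal]; linarith [Nat.ceil_lt_add_one hP₁0.le]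
  have hUge : P₁ - 1 ≤ U := by rw [hUreal]; linarith [Nat.le_ceil P₁]
  have hPaU : P ≤ U := by
    have : 1 ≤ P * a := by nlinarith
    have : P₁ - 1 = P + (P * a - 1) := by rw [hP₁def]; ring
    linarith
  have hU2 : (2 : ℝ) ≤ U := by linarith
  have hU0 : (0 : ℝ) < U := by linarith
  have hfloorU : ⌊P⌋₊ ≤ U := by
    have : (⌊P⌋₊ : ℝ) ≤ U := (Nat.floor_le hP0.le).trans hPaU
    exact_mod_cast this
  -- `𝔓` as a sum over `P < p ≤ U`
  have hIoo : Finset.Ioo ⌊P⌋₊ ⌈P₁⌉₊ = Finset.Ioc ⌊P⌋₊ U := Ioo_eq_Ioc_sub_one _ _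
  have hfrakP : frakP D = ∑ p ∈ (Finset.Ioc ⌊P⌋₊ U).filter Nat.Prime, (p : ℝ) := by
    rw [frakP_def, ← hIoo]
  -- the window sum of `log p`
  set Θ : ℝ := ∑ p ∈ (Finset.Ioc ⌊P⌋₊ U).filter Nat.Prime, Real.log p with hΘdef
  have hΘ : Θ = Chebyshev.theta U - Chebyshev.theta P := by
    rw [hΘdef, sum_Ioc_log_eq_theta_sub _ _ hfloorU, ← Chebyshev.theta_eq_theta_coe_floor]
  have hθU := hθ' U hU2
  have hθP := hθ' P (by linarith)
  have hEU : C' * U / Real.exp (c * Real.sqrt (Real.log U)) ≤ 2 * C' * P / Real.exp (c * L ^ 4) := by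
    refine div_le_div₀ (by positivity) (by nlinarith [hUlt.le.trans hP₁2P]) hexp4 ?_
    exact Real.exp_le_exp.2 (mul_le_mul_of_nonneg_left (hsqrt U hPaU) hc.le)
  have hEP : C' * P / Real.exp (c * Real.sqrt (Real.log P)) ≤ C' * P / Real.exp (c * L ^ 4) := by
    refine div_le_div_of_nonneg_left (by positivity) hexp4 ?_
    exact Real.exp_le_exp.2 (mul_le_mul_of_nonneg_left (hsqrt P le_rfl) hc.le)
  have hΘup : Θ ≤ P * a + P * a ^ 2 := by
    have h1 : Chebyshev.theta U - U ≤ 2 * C' * P / Real.exp (c * L ^ 4) :=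
      (le_abs_self _).trans (hθU.trans hEU)
    have h2 : -(Chebyshev.theta P - P) ≤ C' * P / Real.exp (c * L ^ 4) :=
      (neg_le_abs _).trans (hθP.trans hEP)
    have h3 : (U : ℝ) - P ≤ P * a := by rw [hP₁def] at hUlt; linarith
    have h4 : 2 * C' * P / Real.exp (c * L ^ 4) + C' * P / Real.exp (c * L ^ 4) =
        3 * C' * P / Real.exp (c * L ^ 4) := by ring
    linarith [hΘ, hεle]
  have hΘlow : P * a - 2 * (P * a ^ 2) ≤ Θ := by
    have h1 : -(Chebyshev.theta U - U) ≤ 2 * C' * P / Real.exp (c * L ^ 4) :=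
      (neg_le_abs _).trans (hθU.trans hEU)
    have h2 : Chebyshev.theta P - P ≤ C' * P / Real.exp (c * L ^ 4) :=
      (le_abs_self _).trans (hθP.trans hEP)
    have h3 : P * a - 1 ≤ (U : ℝ) - P := by rw [hP₁def] at hUge; linarith
    have h4 : 2 * C' * P / Real.exp (c * L ^ 4) + C' * P / Real.exp (c * L ^ 4) =
        3 * C' * P / Real.exp (c * L ^ 4) := by ring
    linarith [hΘ, hεle, h1le]
  -- termwise comparison of `p` with `log p`
  have hlogP₁ : Real.log P₁ ≤ L ^ 9 * (1 + a) := by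
    rw [hP₁def, Real.log_mul hP0.ne' (by linarith), hlogP]
    have : Real.log (1 + a) ≤ a := by linarith [Real.log_le_sub_one_of_pos (by linarith : 0 < 1 + a)]
    nlinarith
  have hlogP₁0 : 0 < Real.log P₁ := Real.log_pos (by linarith)
  have hup : frakP D ≤ P₁ / L ^ 9 * Θ := by
    rw [hfrakP, hΘdef, Finset.mul_sum]
    refine Finset.sum_le_sum fun p hp ↦ ?_
    obtain ⟨hp1, hp2⟩ := Finset.mem_filter.1 hp
    rw [Finset.mem_Ioc] at hp1
    have hpP : P < p := lt_of_lt_of_le (Nat.lt_floor_add_one P) (by exact_mod_cast hp1.1)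
    have hpU : (p : ℝ) ≤ P₁ := le_trans (by exact_mod_cast hp1.2) hUlt.le
    have hp0 : (0 : ℝ) < p := hP0.trans hpP
    have hlogp : L ^ 9 ≤ Real.log p := by rw [← hlogP]; exact Real.log_le_log hP0 hpP.le
    -- `p ≤ (P₁/L⁹) log p` since `p L⁹ ≤ P₁ log p`
    rw [div_mul_eq_mul_div, le_div_iff₀ (by positivity)]
    exact mul_le_mul hpU hlogp (by positivity) hP₁0.le
  have hlow : P / (L ^ 9 * (1 + a)) * Θ ≤ frakP D := by
    rw [hfrakP, hΘdef, Finset.mul_sum]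
    refine Finset.sum_le_sum fun p hp ↦ ?_
    obtain ⟨hp1, hp2⟩ := Finset.mem_filter.1 hp
    rw [Finset.mem_Ioc] at hp1
    have hpP : P < p := lt_of_lt_of_le (Nat.lt_floor_add_one P) (by exact_mod_cast hp1.1)
    have hpU : (p : ℝ) ≤ P₁ := le_trans (by exact_mod_cast hp1.2) hUlt.le
    have hp0 : (0 : ℝ) < p := hP0.trans hpP
    have hlogp : Real.log p ≤ L ^ 9 * (1 + a) :=
      (Real.log_le_log hp0 hpU).trans hlogP₁
    have hlogp0 : 0 ≤ Real.log p := Real.log_nonneg (by linarith)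
    -- `(P/(L⁹(1+a))) log p ≤ p` since `P log p ≤ p L⁹ (1+a)`
    rw [div_mul_eq_mul_div, div_le_iff₀ (by positivity)]
    exact mul_le_mul hpP.le hlogp hlogp0 hp0.le
  -- assemble
  have hmain : P ^ 2 * (L ^ 77)⁻¹ = P * P * a / L ^ 9 := by
    rw [hadef, div_eq_mul_inv, mul_assoc, mul_assoc, ← mul_inv, ← pow_add]; ring
  rw [abs_le]
  constructor
  · -- lower bound
    have h1 : P / (L ^ 9 * (1 + a)) * (P * a - 2 * (P * a ^ 2)) ≤ frakP D :=
      (mul_le_mul_of_nonneg_left hΘlow (by positivity)).trans hlow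
    have h2 : (1 - 3 * a) * (P * P * a / L ^ 9) ≤ P / (L ^ 9 * (1 + a)) * (P * a - 2 * (P * a ^ 2)) := by
      rw [div_mul_eq_mul_div, le_div_iff₀ (by positivity)]
      have : (1 - 3 * a) * (P * P * a / L ^ 9) * (L ^ 9 * (1 + a)) =
          P * P * a * ((1 - 3 * a) * (1 + a)) := by field_simp
      rw [this]
      have h3 : (1 - 3 * a) * (1 + a) ≤ 1 - 2 * a := by nlinarith
      have h4 : P * (P * a - 2 * (P * a ^ 2)) = P * P * a * (1 - 2 * a) := by ring
      rw [h4]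
      exact mul_le_mul_of_nonneg_left h3 (by positivity)
    rw [hmain]; linarith
  · -- upper bound
    have h1 : frakP D ≤ P₁ / L ^ 9 * (P * a + P * a ^ 2) :=
      hup.trans (mul_le_mul_of_nonneg_left hΘup (by positivity))
    have h2 : P₁ / L ^ 9 * (P * a + P * a ^ 2) ≤ (1 + 3 * a) * (P * P * a / L ^ 9) := by
      rw [hP₁def]
      have e : P * (1 + a) / L ^ 9 * (P * a + P * a ^ 2) =
          ((1 + a) * (1 + a)) * (P * P * a / L ^ 9) := by ring
      rw [e]
      refine mul_le_mul_of_nonneg_right (by nlinarith) (by positivity)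
    rw [hmain]; linarith

end Literature.NumberTheory.LFunctions.Zhang2022

end
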